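import Summits.ValiantsHypothesis.ValiantsHypothesis.Theorems.BarrierLeverKRSTNoGoBelow12cOnB05Admissible

/-!
# Route BarrierLever — item `KRSTNoGoBelow12cOnB05` (stmt-ValiantsHypothesis-19340), part 6/6:
# the asymptotic assembly — conditionally on Bourgain 2005 Thm 2 (`r ≤ 2`), KRST's generator is not
# `VP_{n,b}`-succinct for any `b < 12c`

Lean text authored by the cell planner seat `valiant-natproofs-p2` (gen 3, HOME/RowZero-p2g3.lean v5
§E.12–§E.13, referee REF-P2G3B / REF-ITEMS-g9 PASS; print check of the hypothesis against Bourgain,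
JAMS 18 (2005) Thm 2 (1.24) p.480 under (1.19)–(1.20) p.479 by p1-g5, referee-confirmed REF-G10),
landed by the prover seat; closes the D-0059 item stmt-ValiantsHypothesis-19340 (whose signature
inlines the hypothesis).

* `B05NatAt k` — [B05] at precision `ε = 1/k` in natural-number clothing (a HYPOTHESIS; the item's
  inlined hypothesis is `∀ k, B05NatAt k`).
* `krst_not_idealSuccinct_of_B05_aux` — the asymptotics of memo §4d in `ℕ`: `L = ⌊p^{1/k}⌋` with
  `k = 12c+1`, `t = n-1`, `K₀ = ⌊n/2^{⌊log₂ n/j⌋}⌋+1`, `N₀ = ⌊(m²-L²-1)/(2L²+1)⌋`, threshold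
  `n ≥ 4 + 16·40^k + p₀ + 2^{j(8j+20)} + 2^{96c+20} + 16^{k+1}`.
* **`krst_not_idealSuccinct_eventually_of_B05`** — `(∀ k, B05NatAt k) → 1 ≤ c → b < 12c → ∃ n₀, ∀ n ≥ n₀,
  ¬ IsIdealSuccinctGenerator … (KRST generator, m = n^{3c}, p = leastPrimeGe (m²+n+1))`;
  `krst_not_succinct_eventually_of_B05` (per-seed form via `KRSTEdge.IsSuccinctGenerator.ideal`).
* `krstNoGoBelow12c_of_B05`, `krstNoGoBelow12c_perSeed_of_B05`, and **`krstNoGoBelow12cOnB05`** = the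
  signature of item stmt-ValiantsHypothesis-19340 VERBATIM.

WHAT THIS IS NOT: NOT an unconditional refutation of anything in `b ≥ 6c` — the unconditional band of
record is `b < 6c` (`…Theorems/BarrierLeverKRSTNoGoBelow6c.lean`); Bourgain's theorem is a hypothesis,
not formalised; nothing for `b ≥ 12c` (there the seed dimension `p² ≈ n^{12c}` exceeds every counting
method), nothing about other generators, FSV Question 6 / crux stmt-14610, `VP` vs `VNP`.

References: [Bourgain2005] Thm 2; [KumarRamyaSaptharishiTengse2022] §3.5, §4.
-/

-- layout Summits/ValiantsHypothesis/ValiantsHypothesis forces the duplicated namespace component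
set_option linter.dupNamespace false

noncomputable section

namespace Summit.ValiantsHypothesis.ValiantsHypothesis.Theorems.BarrierLever.KRSTNoGoBelow12cOnB05

open Literature.Barriers.ValiantsHypothesis Literature.Computability.AlgebraicComplexity MvPolynomial
open Summit.ValiantsHypothesis.ValiantsHypothesis.Theorems.BarrierLever.SuccinctHittingSetsForVP
open Summit.ValiantsHypothesis.ValiantsHypothesis.Theorems.BarrierLever.SuccinctHittingSetsForVP.KRSTEdge
open Summit.ValiantsHypothesis.ValiantsHypothesis.Theorems.BarrierLever.KRSTNoGoBelow12cOnB05.CharSum (ψ)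
open Literature.Computability.MetaComplexity (eval_ofFn_eq_sum leastPrimeGe leastPrimeGe_spec leastPrimeGe_le)

variable {p : ℕ} [Fact p.Prime]

/-! ### E.12 The asymptotic assembly: [B05] in natural-number clothing ⇒ the whole band `b < 12c` -/

/-- **Bourgain 2005, Theorem 2 (`r ≤ 2`), natural-number form, at precision `k`** (`ε = 1/k`):
there are `j ≥ 1` (`δ = 1/j`) and `p₀` such that for all primes `p ≥ p₀`: if `p < (L+1)^k` (so order
`> L` means order `> p^ε`), `p < t^k` (`t > p^ε`) and `t^j ≤ K₀^j p` (`K₀ ≥ p^{-δ} t`), the one- and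
two-term orbit sums of length `t` are bounded by `K₀`. For every `k ≥ 1` this follows from
[Bourgain2005, Thm 2 (1.24) p.480 under (1.19)–(1.20) p.479] (J. Bourgain, *Mordell's exponential sum
estimate revisited*, JAMS 18 (2005); cell print check HOME/p1/N27-B05-printcheck-g5.md: the ℕ-form
is weaker than print in four declared places — `ε = 1/k` only, `δ = 1/j`, `∃ p₀`, `≤ K₀` with
`K₀ ≥ p^{-δ}t`). It is a HYPOTHESIS of the theorems below (`∀ k, B05NatAt k` = the inlined hypothesis
of ledger item stmt-ValiantsHypothesis-19340), never proved in Lean. -/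
def B05NatAt (k : ℕ) : Prop :=
  1 ≤ k → ∃ j p₀ : ℕ, 1 ≤ j ∧ ∀ (p : ℕ) [Fact p.Prime], p₀ ≤ p → ∀ L t K₀ : ℕ,
    p < (L + 1) ^ k → p < t ^ k → t ^ j ≤ K₀ ^ j * p →
      OneTermBound p L t K₀ ∧ TwoTermBound p L t K₀

/-- `C (s+3) ≤ 2^s` once `s ≥ 2C + 4`. -/
theorem mul_add_three_le_two_pow (C : ℕ) : ∀ s, 2 * C + 4 ≤ s → C * (s + 3) ≤ 2 ^ s := by
  intro s hs
  induction s, hs using Nat.le_induction with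
  | base =>
    have h1 : C < 2 ^ C := Nat.lt_two_pow_self
    have h2 : 2 ^ (2 * C + 4) = 16 * (2 ^ C * 2 ^ C) := by
      rw [show 2 * C + 4 = C + C + 4 by ring, pow_add, pow_add]; ring
    rw [h2]
    nlinarith
  | succ s hs ih =>
    have hC : C ≤ 2 ^ s :=
      (Nat.lt_two_pow_self (n := C)).le.trans (Nat.pow_le_pow_right (by norm_num) (by omega))
    rw [pow_succ]
    nlinarith

/-- `4(ℓ+2) ≤ 2^{⌊ℓ/j⌋}` once `ℓ ≥ j(8j+20)`. -/
theorem four_mul_le_two_pow_div (ℓ j : ℕ) (hj : 1 ≤ j) (hℓj : j * (8 * j + 20) ≤ ℓ) :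
    4 * (ℓ + 2) ≤ 2 ^ (ℓ / j) := by
  set v := ℓ / j with hv
  have hv1 : ℓ < (v + 1) * j := by
    rw [hv, add_mul, one_mul]; exact Nat.lt_div_mul_add (by omega)
  have hv2 : 8 * j + 20 ≤ v := by
    rw [hv]; exact (Nat.le_div_iff_mul_le (by omega)).mpr (by nlinarith [hℓj])
  have h3 := mul_add_three_le_two_pow (4 * j + 8) v (by omega)
  calc 4 * (ℓ + 2) ≤ (4 * j + 8) * (v + 3) := by nlinarith [hv1]
    _ ≤ 2 ^ v := h3

/-- The counting inequality behind `hK` (memo §4d (i)). -/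
theorem key_count (M X' Y : ℕ) (hS1 : 8 * (X' + 1) ≤ M) (hS2 : 4 * (X' + 1) * Y ≤ M * M) :
    Y < (M - (X' + 1)) / (2 * X' + 1) * M := by
  set D := 2 * X' + 1 with hD
  set N₀ := (M - (X' + 1)) / D with hN₀
  have hDpos : 0 < D := by omega
  have h1 : M - (X' + 1) < N₀ * D + D := Nat.lt_div_mul_add hDpos
  have h2 : 5 * M ≤ 8 * (N₀ * D) := by omega
  have hM : 1 ≤ M := by omega
  have h2' : 5 * M * M ≤ 8 * (N₀ * D) * M := Nat.mul_le_mul_right M h2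
  have hMM : 1 ≤ M * M := Nat.mul_le_mul hM hM
  have h3 : 8 * (Y * D) < 8 * (N₀ * D * M) := by nlinarith
  have h4 : Y * D < (N₀ * M) * D := by nlinarith
  exact Nat.lt_of_mul_lt_mul_right h4

/-- Arithmetic for the admissible-set count (second form). -/
theorem key_count' (M X' Y' : ℕ) (hX : 1 ≤ X') (hY : 1 ≤ Y') (hS1 : 16 * X' ≤ M)
    (hS2 : 40 * Y' * X' ≤ M * M) : 4 * Y' + 1 < (M - (X' + 1)) / (2 * X' + 1) * M := by
  refine key_count M X' (4 * Y' + 1) (by omega) ?_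
  nlinarith [Nat.mul_le_mul_left X' hY, Nat.mul_le_mul_right Y' hX]

/-- `2n ≤ (n-1)²` for `n ≥ 4`. -/
theorem two_mul_le_pred_mul_pred (n : ℕ) (hn : 4 ≤ n) : 2 * n ≤ (n - 1) * (n - 1) := by
  obtain ⟨t, rfl⟩ : ∃ t, n = t + 4 := ⟨n - 4, by omega⟩
  rw [show t + 4 - 1 = t + 3 by omega]
  nlinarith

/-- Integer `k`-th roots: `L = ⌊p^{1/k}⌋`. -/
theorem exists_nat_root (p k : ℕ) (hk : k ≠ 0) : ∃ L : ℕ, L ^ k ≤ p ∧ p < (L + 1) ^ k := by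
  classical
  have hex : ∃ L : ℕ, p < (L + 1) ^ k :=
    ⟨p, lt_of_lt_of_le (Nat.lt_succ_self p) (Nat.le_self_pow hk (p + 1))⟩
  refine ⟨Nat.find hex, ?_, Nat.find_spec hex⟩
  rcases Nat.eq_zero_or_pos (Nat.find hex) with h0 | hpos
  · rw [h0, zero_pow hk]; exact Nat.zero_le _
  · have := Nat.find_min hex (show Nat.find hex - 1 < Nat.find hex by omega)
    rw [Nat.sub_add_cancel hpos] at this
    exact not_lt.mp this

/-- Binary logarithm with the two thresholds we need. -/
theorem exists_log (n a₁ a₂ : ℕ) (hn : n ≠ 0) (h₁ : 2 ^ a₁ ≤ n) (h₂ : 2 ^ a₂ ≤ n) :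
    ∃ ℓ : ℕ, 2 ^ ℓ ≤ n ∧ n < 2 ^ (ℓ + 1) ∧ a₁ ≤ ℓ ∧ a₂ ≤ ℓ :=
  ⟨Nat.log 2 n, Nat.pow_log_le_self 2 hn, Nat.lt_pow_succ_log_self (by norm_num) n,
    Nat.le_log_of_pow_le (by norm_num) h₁, Nat.le_log_of_pow_le (by norm_num) h₂⟩

set_option maxHeartbeats 1000000 in
/-- The conditional no-go at a GIVEN prime `p ∈ [m²+n+1, 2(m²+n+1)]`, `m = n^{3c}`, for `n` beyond an
explicit threshold (all the asymptotics of memo §4d (i)–(ii), in elementary natural-number form). -/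
theorem krst_not_idealSuccinct_of_B05_aux {c b k j p₀ : ℕ} (hc : 1 ≤ c) (hb : b < 12 * c)
    (hk : k = 12 * c + 1) (hj : 1 ≤ j)
    (hB : ∀ (p : ℕ) [Fact p.Prime], p₀ ≤ p → ∀ L t K₀ : ℕ,
      p < (L + 1) ^ k → p < t ^ k → t ^ j ≤ K₀ ^ j * p → OneTermBound p L t K₀ ∧ TwoTermBound p L t K₀)
    {n : ℕ} (hn : 4 + 16 * 40 ^ k + p₀ + 2 ^ (j * (8 * j + 20)) + 2 ^ (96 * c + 20) + 16 ^ (k + 1) ≤ n)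
    (hNp : n ^ (3 * c) * n ^ (3 * c) + n + 1 ≤ p) (hp2N : p ≤ 2 * (n ^ (3 * c) * n ^ (3 * c) + n + 1))
    (hmp : n ^ (3 * c) * n ^ (3 * c) ≤ p) :
    ¬ IsIdealSuccinctGenerator (degLEMonomials n) (SmallCircuits ℂ n b) (krstGen ℂ p n hmp) := by
  classical
  have hkpos : k ≠ 0 := by omega
  have hexp1 : 12 * c + 1 ≤ 6 * c * k := by rw [hk]; nlinarith
  have hexp2 : b * k + 12 * c + 1 ≤ 12 * c * k := by
    rw [hk]
    have : b + 1 ≤ 12 * c := by omega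
    nlinarith
  -- unpack the threshold (name the powers so that `omega` sees plain naturals)
  obtain ⟨P1, hP1⟩ : ∃ P1, P1 = 40 ^ k := ⟨_, rfl⟩
  obtain ⟨P2, hP2⟩ : ∃ P2, P2 = 2 ^ (j * (8 * j + 20)) := ⟨_, rfl⟩
  obtain ⟨P3, hP3⟩ : ∃ P3, P3 = 2 ^ (96 * c + 20) := ⟨_, rfl⟩
  obtain ⟨P4, hP4⟩ : ∃ P4, P4 = 16 ^ (k + 1) := ⟨_, rfl⟩
  rw [← hP1, ← hP2, ← hP3, ← hP4] at hn
  have hn4 : 4 ≤ n := by omega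
  have hn1 : 1 ≤ n := by omega
  have hn40 : 16 * 40 ^ k ≤ n := by rw [← hP1]; omega
  have hnP2 : 2 ^ (j * (8 * j + 20)) ≤ n := by rw [← hP2]; omega
  have hnP3 : 2 ^ (96 * c + 20) ≤ n := by rw [← hP3]; omega
  have hnP4 : 16 ^ (k + 1) ≤ n := by rw [← hP4]; omega
  -- the parameters (`M = m² = n^{6c}`)
  obtain ⟨M, hMdef⟩ : ∃ M, M = n ^ (3 * c) * n ^ (3 * c) := ⟨_, rfl⟩
  have hmm : M = n ^ (6 * c) := by rw [hMdef, ← pow_add]; ring_nf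
  have hMM : M * M = n ^ (12 * c) := by rw [hmm, ← pow_add]; ring_nf
  rw [← hMdef] at hNp hp2N
  have hM1 : n + 1 ≤ M := by
    rw [hmm]
    calc n + 1 ≤ n * n := by have := Nat.mul_le_mul_left n hn4; omega
      _ = n ^ 2 := by ring
      _ ≤ n ^ (6 * c) := Nat.pow_le_pow_right hn1 (by omega)
  have hp4 : p ≤ 4 * M := by omega
  have hnp : n < p := by omega
  have hpm1 : M ≤ p - 1 := by omega
  have hp₀ : p₀ ≤ p := by omega
  have hp2 : 2 ≤ p := (Fact.out : p.Prime).two_le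
  -- L = ⌊p^{1/k}⌋
  obtain ⟨L, hL2, hL1⟩ := exists_nat_root p k hkpos
  have hLpos : 1 ≤ L := by
    by_contra h
    have h0 : L = 0 := by omega
    rw [h0, zero_add, one_pow] at hL1
    omega
  have hLL : 1 ≤ L * L := Nat.mul_le_mul hLpos hLpos
  -- (S1): 16 L² ≤ n^{6c};  (S2): 40 n^b L² ≤ n^{12c}
  have hL2k : (L * L) ^ k ≤ 16 * n ^ (12 * c) := by
    calc (L * L) ^ k = L ^ k * L ^ k := by rw [mul_pow]
      _ ≤ p * p := Nat.mul_le_mul hL2 hL2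
      _ ≤ (4 * M) * (4 * M) := Nat.mul_le_mul hp4 hp4
      _ = 16 * n ^ (12 * c) := by rw [← hMM]; ring
  have hS1 : 16 * (L * L) ≤ M := by
    rw [hmm, ← Nat.pow_le_pow_iff_left hkpos]
    calc (16 * (L * L)) ^ k = 16 ^ k * (L * L) ^ k := by rw [mul_pow]
      _ ≤ 16 ^ k * (16 * n ^ (12 * c)) := Nat.mul_le_mul_left _ hL2k
      _ = 16 ^ (k + 1) * n ^ (12 * c) := by ring
      _ ≤ n * n ^ (12 * c) := Nat.mul_le_mul_right _ hnP4
      _ = n ^ (12 * c + 1) := by ring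
      _ ≤ n ^ (6 * c * k) := Nat.pow_le_pow_right hn1 hexp1
      _ = (n ^ (6 * c)) ^ k := by rw [pow_mul]
  have hS2 : 40 * n ^ b * (L * L) ≤ M * M := by
    rw [hMM, ← Nat.pow_le_pow_iff_left hkpos]
    calc (40 * n ^ b * (L * L)) ^ k = 40 ^ k * (n ^ b) ^ k * (L * L) ^ k := by
          rw [mul_pow, mul_pow]
      _ ≤ 40 ^ k * (n ^ b) ^ k * (16 * n ^ (12 * c)) := Nat.mul_le_mul_left _ hL2k
      _ = 16 * 40 ^ k * (n ^ (b * k) * n ^ (12 * c)) := by rw [← pow_mul]; ring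
      _ ≤ n * (n ^ (b * k) * n ^ (12 * c)) := Nat.mul_le_mul_right _ hn40
      _ = n ^ (b * k + 12 * c + 1) := by ring
      _ ≤ n ^ (12 * c * k) := Nat.pow_le_pow_right hn1 hexp2
      _ = (n ^ (12 * c)) ^ k := by rw [pow_mul]
  -- N₀ and the counting inequality
  have hnb : 1 ≤ n ^ b := Nat.one_le_pow _ _ (by omega)
  have hK' := key_count' M (L * L) (n ^ b) hLL hnb hS1 hS2
  have hN₀D' := Nat.div_mul_le_self (M - (L * L + 1)) (2 * (L * L) + 1)
  obtain ⟨N₀, hN₀def⟩ : ∃ N₀, N₀ = (M - (L * L + 1)) / (2 * (L * L) + 1) := ⟨_, rfl⟩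
  rw [← hN₀def] at hK' hN₀D'
  have hN₀le : N₀ * (2 * (L * L) + 1) + (L * L + 1) ≤ M := by omega
  have hN₀M : N₀ ≤ M :=
    le_trans (Nat.le_mul_of_pos_right _ (by omega)) (le_trans hN₀D' (Nat.sub_le _ _))
  have hK : 4 * n ^ b + 1 < N₀ * (p - 1) := lt_of_lt_of_le hK' (Nat.mul_le_mul_left _ hpm1)
  -- t = n - 1 > p^{1/k}
  have ht : p < (n - 1) ^ k := by
    have h1 : 2 * n ≤ (n - 1) * (n - 1) := two_mul_le_pred_mul_pred n hn4
    have hpow : 0 < n ^ (6 * c) := pow_pos (by omega) _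
    calc p ≤ 4 * M := hp4
      _ = 4 * n ^ (6 * c) := by rw [hmm]
      _ < 64 * n ^ (6 * c) := by omega
      _ ≤ 2 ^ (6 * c) * n ^ (6 * c) := Nat.mul_le_mul_right _
          (by calc (64 : ℕ) = 2 ^ 6 := by norm_num
                _ ≤ 2 ^ (6 * c) := Nat.pow_le_pow_right (by norm_num) (by omega))
      _ = (2 * n) ^ (6 * c) := by rw [mul_pow]
      _ ≤ ((n - 1) * (n - 1)) ^ (6 * c) := Nat.pow_le_pow_left h1 _
      _ = (n - 1) ^ (12 * c) := by rw [← pow_two, ← pow_mul]; ring_nf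
      _ ≤ (n - 1) ^ k := Nat.pow_le_pow_right (by omega) (by omega)
  -- ℓ = log₂ n, R = 2^{ℓ/j}, K₀ = n/R + 1
  obtain ⟨ℓ, hℓ1, hℓ2, hℓj, hℓc⟩ := exists_log n _ _ (by omega) hnP2 hnP3
  obtain ⟨R, hRdef⟩ : ∃ R, R = 2 ^ (ℓ / j) := ⟨_, rfl⟩
  have hRpos : 0 < R := by rw [hRdef]; exact pow_pos (by norm_num) _
  have hRj : R ^ j ≤ n := by
    calc R ^ j = 2 ^ (ℓ / j * j) := by rw [hRdef, ← pow_mul]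
      _ ≤ 2 ^ ℓ := Nat.pow_le_pow_right (by norm_num) (Nat.div_mul_le_self ℓ j)
      _ ≤ n := hℓ1
  have hR4 : 4 * (ℓ + 2) ≤ R := by rw [hRdef]; exact four_mul_le_two_pow_div ℓ j hj hℓj
  have hq1' := (Nat.lt_div_mul_add (a := n) hRpos).le
  have hq2' := Nat.div_mul_le_self n R
  have hq3' : n / R < n := Nat.div_lt_self (by omega) (by omega)
  obtain ⟨q, hqdef⟩ : ∃ q, q = n / R := ⟨_, rfl⟩
  rw [← hqdef] at hq1' hq2' hq3'
  have hK₀R : n ≤ (q + 1) * R := by rw [add_mul, one_mul]; exact hq1'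
  have hK₀j : (n - 1) ^ j ≤ (q + 1) ^ j * p := by
    calc (n - 1) ^ j ≤ n ^ j := Nat.pow_le_pow_left (by omega) _
      _ ≤ ((q + 1) * R) ^ j := Nat.pow_le_pow_left hK₀R _
      _ = (q + 1) ^ j * R ^ j := by rw [mul_pow]
      _ ≤ (q + 1) ^ j * n := Nat.mul_le_mul_left _ hRj
      _ ≤ (q + 1) ^ j * p := Nat.mul_le_mul_left _ hnp.le
  -- [B05] at p
  obtain ⟨h1, h2⟩ := hB p hp₀ L (n - 1) (q + 1) hL1 ht hK₀j
  -- hdom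
  have hdom : (N₀ * (p - 1) - 1) * (q + 1 + 1 + n).choose n < 2 ^ n := by
    have hNp1 : N₀ * (p - 1) ≤ 4 * n ^ (12 * c) := by
      calc N₀ * (p - 1) ≤ M * (4 * M) := Nat.mul_le_mul hN₀M (by omega)
        _ = 4 * n ^ (12 * c) := by rw [← hMM]; ring
    have A1 : N₀ * (p - 1) - 1 < 4 * n ^ (12 * c) := by
      have : 0 < n ^ (12 * c) := pow_pos (by omega) _
      omega
    have A3 : 4 * n ^ (12 * c) ≤ 2 ^ (12 * c * (ℓ + 1) + 2) := by
      calc 4 * n ^ (12 * c) ≤ 4 * (2 ^ (ℓ + 1)) ^ (12 * c) :=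
            Nat.mul_le_mul_left _ (Nat.pow_le_pow_left hℓ2.le _)
        _ = 2 ^ (12 * c * (ℓ + 1) + 2) := by rw [← pow_mul, pow_add]; ring
    have A2 : (q + 1 + 1 + n).choose n ≤ 2 ^ ((ℓ + 2) * (q + 2)) := by
      have hsymm : (q + 1 + 1 + n).choose n = (q + 1 + 1 + n).choose (q + 1 + 1) :=
        (Nat.choose_symm_add (a := q + 1 + 1) (b := n)).symm
      rw [hsymm]
      calc (q + 1 + 1 + n).choose (q + 1 + 1) ≤ (q + 1 + 1 + n) ^ (q + 1 + 1) := Nat.choose_le_pow _ _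
        _ ≤ (2 ^ (ℓ + 2)) ^ (q + 1 + 1) := by
            refine Nat.pow_le_pow_left ?_ _
            rw [pow_succ]; omega
        _ = 2 ^ ((ℓ + 2) * (q + 2)) := by rw [← pow_mul]
    have A4 : 12 * c * (ℓ + 1) + 2 + (ℓ + 2) * (q + 2) ≤ n := by
      have e1 : 4 * ((ℓ + 2) * q) ≤ n := by
        calc 4 * ((ℓ + 2) * q) = (4 * (ℓ + 2)) * q := by ring
          _ ≤ R * q := Nat.mul_le_mul_right _ hR4
          _ ≤ n := by rw [mul_comm]; exact hq2'
      have e2 : (48 * c + 8) * (ℓ + 3) ≤ 2 ^ ℓ :=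
        mul_add_three_le_two_pow (48 * c + 8) ℓ (by omega)
      linarith [e1, e2, hℓ1]
    have hpos : 0 < 2 ^ ((ℓ + 2) * (q + 2)) := pow_pos (by norm_num) _
    calc (N₀ * (p - 1) - 1) * (q + 1 + 1 + n).choose n
        ≤ (N₀ * (p - 1) - 1) * 2 ^ ((ℓ + 2) * (q + 2)) := Nat.mul_le_mul_left _ A2
      _ < 4 * n ^ (12 * c) * 2 ^ ((ℓ + 2) * (q + 2)) := mul_lt_mul_of_pos_right A1 hpos
      _ ≤ 2 ^ (12 * c * (ℓ + 1) + 2) * 2 ^ ((ℓ + 2) * (q + 2)) := Nat.mul_le_mul_right _ A3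
      _ = 2 ^ (12 * c * (ℓ + 1) + 2 + (ℓ + 2) * (q + 2)) := by rw [← pow_add]
      _ ≤ 2 ^ n := Nat.pow_le_pow_right (by norm_num) A4
  have hmp' : M ≤ p := by omega
  have hN₀le' : N₀ * (2 * (L * L) + 1) + (L * L + 1) ≤ n ^ (3 * c) * n ^ (3 * c) := by
    rw [← hMdef]; exact hN₀le
  exact krst_not_idealSuccinct_of_B05At' hmp hnp L (q + 1) N₀ h1 h2 hN₀le' hdom hK

set_option maxHeartbeats 400000 in
/-- **The residual band, conditionally (memo §4c–§4d, now kernel except for [B05] itself).** Assuming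
`∀ k, B05NatAt k`, for every `c ≥ 1` and every `b < 12c`, KRST's generator (block size `m = n^{3c}`, prime
`p = leastPrimeGe (m² + n + 1)`, exactly the data of the route item texts S1A/S2A) is, for all large `n`,
NOT ideal-succinct for `SmallCircuits ℂ n b` — hence not per-seed succinct either. (`b ≥ 12c + 1` is
beyond every rank argument: transcendence degree `≤ p²`.) -/
theorem krst_not_idealSuccinct_eventually_of_B05 (hB : ∀ k, B05NatAt k) {c b : ℕ} (hc : 1 ≤ c)
    (hb : b < 12 * c) :
    ∃ n₀ : ℕ, ∀ n ≥ n₀, ¬ IsIdealSuccinctGenerator (degLEMonomials n) (SmallCircuits ℂ n b)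
      (@krstGen ℂ _ (leastPrimeGe (n ^ (3 * c) * n ^ (3 * c) + n + 1)) n
        ⟨(leastPrimeGe_spec (n ^ (3 * c) * n ^ (3 * c) + n + 1)).2⟩ (n ^ (3 * c))
        (le_trans (Nat.le_add_right (n ^ (3 * c) * n ^ (3 * c)) (n + 1))
          (leastPrimeGe_spec (n ^ (3 * c) * n ^ (3 * c) + n + 1)).1)) := by
  obtain ⟨j, p₀, hj, hB⟩ := hB (12 * c + 1) (by omega)
  refine ⟨4 + 16 * 40 ^ (12 * c + 1) + p₀ + 2 ^ (j * (8 * j + 20)) + 2 ^ (96 * c + 20) +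
    16 ^ (12 * c + 1 + 1), fun n hn => ?_⟩
  haveI : Fact (leastPrimeGe (n ^ (3 * c) * n ^ (3 * c) + n + 1)).Prime :=
    ⟨(leastPrimeGe_spec (n ^ (3 * c) * n ^ (3 * c) + n + 1)).2⟩
  exact krst_not_idealSuccinct_of_B05_aux hc hb rfl hj hB hn
    (leastPrimeGe_spec (n ^ (3 * c) * n ^ (3 * c) + n + 1)).1
    (leastPrimeGe_le _ (by omega)) _

/-- The PER-SEED form (the D-0059 item text S1A, `KRSTResidualBandPerSeed`, restricted to `b < 12c`):
per-seed succinct ⇒ ideal-succinct over `ℂ` (tree lemma `KRSTEdge.IsSuccinctGenerator.ideal`). -/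
theorem krst_not_succinct_eventually_of_B05 (hB : ∀ k, B05NatAt k) {c b : ℕ} (hc : 1 ≤ c) (hb : b < 12 * c) :
    ∃ n₀ : ℕ, ∀ n ≥ n₀, ¬ IsSuccinctGenerator (degLEMonomials n) (SmallCircuits ℂ n b)
      (@krstGen ℂ _ (leastPrimeGe (n ^ (3 * c) * n ^ (3 * c) + n + 1)) n
        ⟨(leastPrimeGe_spec (n ^ (3 * c) * n ^ (3 * c) + n + 1)).2⟩ (n ^ (3 * c))
        (le_trans (Nat.le_add_right (n ^ (3 * c) * n ^ (3 * c)) (n + 1))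
          (leastPrimeGe_spec (n ^ (3 * c) * n ^ (3 * c) + n + 1)).1)) := by
  obtain ⟨n₀, h⟩ := krst_not_idealSuccinct_eventually_of_B05 hB hc hb
  refine ⟨n₀, fun n hn hsucc => h n hn ?_⟩
  haveI : Fact (leastPrimeGe (n ^ (3 * c) * n ^ (3 * c) + n + 1)).Prime :=
    ⟨(leastPrimeGe_spec (n ^ (3 * c) * n ^ (3 * c) + n + 1)).2⟩
  exact KRSTEdge.IsSuccinctGenerator.ideal hsucc

/-! ### E.13 The band `b < 12c` in the shape of the ledger items -/

/-- **`KRSTNoGoBelow12c`, conditionally on [B05]** — the same shape with `12c` for `6c`. -/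
theorem krstNoGoBelow12c_of_B05 (hB : ∀ k, B05NatAt k) : ∀ c b : ℕ, b < 12 * c → ¬ (∃ n₀ : ℕ, ∀ n ≥ n₀,
    IsIdealSuccinctGenerator (degLEMonomials n) (SmallCircuits ℂ n b)
      (@krstGen ℂ _ (leastPrimeGe (n ^ (3 * c) * n ^ (3 * c) + n + 1)) n
        ⟨(leastPrimeGe_spec (n ^ (3 * c) * n ^ (3 * c) + n + 1)).2⟩ (n ^ (3 * c))
        (le_trans (Nat.le_add_right (n ^ (3 * c) * n ^ (3 * c)) (n + 1))
          (leastPrimeGe_spec (n ^ (3 * c) * n ^ (3 * c) + n + 1)).1))) := by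
  rintro c b hb ⟨n₀, h⟩
  have hc : 1 ≤ c := by omega
  obtain ⟨n₁, h₁⟩ := krst_not_idealSuccinct_eventually_of_B05 hB hc hb
  exact h₁ (max n₀ n₁) (le_max_right _ _) (h _ (le_max_left _ _))

/-- The per-seed grade of `krstNoGoBelow12c_of_B05` (per-seed ⇒ ideal over a field, `KRSTEdge.IsSuccinctGenerator.ideal`). -/
theorem krstNoGoBelow12c_perSeed_of_B05 (hB : ∀ k, B05NatAt k) : ∀ c b : ℕ, b < 12 * c → ¬ (∃ n₀ : ℕ, ∀ n ≥ n₀,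
    IsSuccinctGenerator (degLEMonomials n) (SmallCircuits ℂ n b)
      (@krstGen ℂ _ (leastPrimeGe (n ^ (3 * c) * n ^ (3 * c) + n + 1)) n
        ⟨(leastPrimeGe_spec (n ^ (3 * c) * n ^ (3 * c) + n + 1)).2⟩ (n ^ (3 * c))
        (le_trans (Nat.le_add_right (n ^ (3 * c) * n ^ (3 * c)) (n + 1))
          (leastPrimeGe_spec (n ^ (3 * c) * n ^ (3 * c) + n + 1)).1))) := by
  rintro c b hb ⟨n₀, h⟩
  have hc : 1 ≤ c := by omega
  obtain ⟨n₁, h₁⟩ := krst_not_succinct_eventually_of_B05 hB hc hb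
  exact h₁ (max n₀ n₁) (le_max_right _ _) (h _ (le_max_left _ _))

/-- **`KRSTNoGoBelow12cOnB05`** (ledger item stmt-ValiantsHypothesis-19340, filed by the cell planner p1
gen 4; signature character for character — the hypothesis is Bourgain 2005 Thm 2 for `r ≤ 2` in
natural-number clothing, `∀ k, B05NatAt k` with everything inlined): CONDITIONALLY on that hypothesis,
for every `c` and every `b < 12c`, KRST's generator (block `m = n^{3c}`, `p` the least prime
`≥ m² + n + 1`) is NOT eventually ideal-succinct for `SmallCircuits ℂ n b`. Proof:
`krstNoGoBelow12c_of_B05` (the inlined hypothesis is `∀ k, B05NatAt k` definitionally). -/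
theorem krstNoGoBelow12cOnB05 : (∀ k : ℕ, 1 ≤ k → ∃ j p₀ : ℕ, 1 ≤ j ∧ ∀ (p : ℕ) [Fact p.Prime], p₀ ≤ p → ∀ L t K₀ : ℕ, p < (L + 1) ^ k → p < t ^ k → t ^ j ≤ K₀ ^ j * p → (∀ θ : ZMod p, θ ≠ 0 → L < orderOf θ → ∀ a : ZMod p, a ≠ 0 → ‖∑ s : Fin t, ((ZMod.stdAddChar : AddChar (ZMod p) ℂ) (a * θ ^ ((s : ℕ) + 1)) : ℂ)‖ ≤ K₀) ∧ (∀ θ₁ θ₂ : ZMod p, θ₁ ≠ 0 → θ₂ ≠ 0 → L < orderOf θ₁ → L < orderOf θ₂ → L < orderOf (θ₁ * θ₂⁻¹) → ∀ a₁ a₂ : ZMod p, a₁ ≠ 0 → a₂ ≠ 0 → ‖∑ s : Fin t, ((ZMod.stdAddChar : AddChar (ZMod p) ℂ) (a₁ * θ₁ ^ ((s : ℕ) + 1) + a₂ * θ₂ ^ ((s : ℕ) + 1)) : ℂ)‖ ≤ K₀)) → ∀ c b : ℕ, b < 12 * c → ¬ (∃ n₀ : ℕ, ∀ n ≥ n₀,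 Summit.ValiantsHypothesis.ValiantsHypothesis.Theorems.BarrierLever.SuccinctHittingSetsForVP.KRSTEdge.IsIdealSuccinctGenerator (Literature.Barriers.ValiantsHypothesis.degLEMonomials n) (Literature.Barriers.ValiantsHypothesis.SmallCircuits ℂ n b) (@Summit.ValiantsHypothesis.ValiantsHypothesis.Theorems.BarrierLever.SuccinctHittingSetsForVP.KRSTEdge.krstGen ℂ _ (Literature.Computability.MetaComplexity.leastPrimeGe (n ^ (3 * c) * n ^ (3 * c) + n + 1)) n ⟨(Literature.Computability.MetaComplexity.leastPrimeGe_spec (n ^ (3 * c) * n ^ (3 * c) + n + 1)).2⟩ (n ^ (3 * c)) (le_trans (Nat.le_add_right (n ^ (3 * c) * n ^ (3 * c)) (n + 1)) (Literature.Computability.MetaComplexity.leastPrimeGe_spec (n ^ (3 * c) * n ^ (3 * c) + n + 1)).1))) :=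
  fun hB => krstNoGoBelow12c_of_B05 hB

end Summit.ValiantsHypothesis.ValiantsHypothesis.Theorems.BarrierLever.KRSTNoGoBelow12cOnB05

end
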